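import Mathlib
import Summits.KontsevichZagierPeriods.Zeta5Search.DenomLaw.RuleRABFamily
import Summits.KontsevichZagierPeriods.Zeta5Search.DenomLaw.RuleRABFamilyCell2
import Summits.KontsevichZagierPeriods.Zeta5Search.DenomLaw.RuleRABFamilyCell3
import Summits.KontsevichZagierPeriods.Zeta5Search.DenomLaw.RuleRABFamilyCell4
import Summits.KontsevichZagierPeriods.Zeta5Search.DenomLaw.RuleRABFamilyCell5
import Summits.KontsevichZagierPeriods.Zeta5Search.DenomLaw.RuleRABFamilyCell6
import HarnessLib

/-!
# ζ(5) search — DENOM-LAW, Rule R2 on the A/B linear family: the statement-file cells BY NAME, and the census directions (prover-d1 gen 2)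

HONEST FRAMING: systematic search; no irrationality claim unless certified.  Cell `pub-zeta5`, track «DENOM-LAW», seat `denom-prover-d1`
gen 2 (ATTEMPT-3).  This file discharges BY NAME five of the six `Prop`s of the statement file `DenomLaw/RuleRABFamily.lean` from the cell
theorems `RuleRAB.cell2 … cell6` (`RuleRABFamilyCell2…6.lean`: THEOREM LB / the Lemma-D bonus through class-type covers, all `t` above the
stated threshold, all `n ≥ 1`), identifies the family with the census's A/B directions
`a = (t+3, t+5, t+5, t+4, t+7, t+11, t+13, t+8)` through Brown–Zudilin's `bOfA` (`bOfA_abFamily`), and records the two directions the track's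
tables name (A18: `t = 15`; B20: `t = 17`) as corollaries.  The sixth `Prop`, `RuleR2ABTopCell` (`−13` on the top cell), stays OBSERVED: the
tree's class laws give `−14` there (`ruleR2ABTopCellLB_holds`).  Valuations of explicit rationals; every model exponent these feed is `< 1`
— no irrationality content; Brown–Zudilin's records in print are UNMOVED.
-/

namespace Summit.KontsevichZagierPeriods.Zeta5Search.DenomLaw

open Summit.KontsevichZagierPeriods.Zeta5Search.CasoratianValuation (casoratian)
open Summit.KontsevichZagierPeriods.Zeta5Search.CellKit (bLin)
open Summit.KontsevichZagierPeriods.Zeta5Search.RuleRAB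

/-! ## §1 The statement-file cells are theorems -/

/-- **`RuleR2ABCell3` is a theorem** (cell `(t+3)n < p ≤ (t+4)n`, bound `−13` = Rule R2's value; all `t ≥ 5`, `n ≥ 1`). -/
theorem ruleR2ABCell3_holds : RuleR2ABCell3 :=
  fun t n p ht hn hp hA hB hne => cell3 t n p ht hn hp hA hB hne

/-- **`RuleR2ABCell4` is a theorem** (cell `(t+4)n < p ≤ (t+5)n`, bound `−13`; all `t ≥ 3`, `n ≥ 1`). -/
theorem ruleR2ABCell4_holds : RuleR2ABCell4 :=
  fun t n p ht hn hp hA hB hne => cell4 t n p ht hn hp hA hB hne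

/-- **`RuleR2ABCell5` is a theorem** (cell `(t+5)n < p ≤ (t+6)n`, bound `−12` by the Lemma-D bonus; all `t ≥ 2`, `n ≥ 1`). -/
theorem ruleR2ABCell5_holds : RuleR2ABCell5 :=
  fun t n p ht hn hp hA hB hne => cell5 t n p ht hn hp hA hB hne

/-- **`RuleR2ABCell6` is a theorem** (cell `(t+6)n < p ≤ (t+7)n`, bound `−11`; all `t ≥ 1`, `n ≥ 1`). -/
theorem ruleR2ABCell6_holds : RuleR2ABCell6 :=
  fun t n p ht hn hp hA hB hne => cell6 t n p ht hn hp hA hB hne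

/-- **`RuleR2ABTopCellLB` is a theorem** (top cell `(t+2)n < p ≤ (t+3)n`, the provable bound `−14`; all `t ≥ 7`, `n ≥ 1`).  Rule R2's
value `−13` there (`RuleR2ABTopCell`) remains OBSERVED. -/
theorem ruleR2ABTopCellLB_holds : RuleR2ABTopCellLB :=
  fun t n p ht hn hp hA hB hne => cell2 t n p ht hn hp hA hB hne

/-! ## §2 The family is the dual of the census's A/B directions -/

section Directions

open Literature.NumberTheory.Irrationality.BrownZudilin2022 (bOfA)

/-- **`b(n·a) = bLin (t n) (t n + 2n) n`** for the A/B direction `a = (t+3, t+5, t+5, t+4, t+7, t+11, t+13, t+8)` (the census's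
`(k, k+2, k+2, k+1, k+4, k+8, k+10, k+5)` with `k = t+3`): its Brown–Zudilin dual parameter vector is `n·(3t+14; t+6, …, t)`. -/
theorem bOfA_abFamily (t n : ℕ) :
    bOfA (fun i => (n : ℤ) * (![(t : ℤ) + 3, t + 5, t + 5, t + 4, t + 7, t + 11, t + 13, t + 8] : Fin 8 → ℤ) i) =
      bLin (t * n) (t * n + 2 * n) n := by
  funext j
  rcases j with _ | _ | _ | _ | _ | _ | _ | _ | j
  all_goals first
    | (simp [bLin, bOfA]; ring)
    | simp [bLin, bOfA]

/-- **A18** (`a = (18,20,20,19,22,26,28,23)`, `t = 15`, dual ray `n·(59; 21,…,15)`): on `18n < p ≤ 19n`, `v_p(Cas₇) ≥ −13`;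
on `19n < p ≤ 20n`, `≥ −13`; on `20n < p ≤ 21n`, `≥ −12`; on `21n < p ≤ 22n`, `≥ −11` (Rule R2's values; all `n ≥ 1`), and on the top cell
`17n < p ≤ 18n` the provable `−14`. -/
theorem a18_cells (n p : ℕ) (hn : 1 ≤ n) (hp : p.Prime) (hne : casoratian (bLin (15 * n) (15 * n + 2 * n) n) 7 ≠ 0) :
    (17 * n < p → p ≤ 18 * n → (-14 : ℤ) ≤ padicValRat p (casoratian (bLin (15 * n) (15 * n + 2 * n) n) 7)) ∧
    (18 * n < p → p ≤ 19 * n → (-13 : ℤ) ≤ padicValRat p (casoratian (bLin (15 * n) (15 * n + 2 * n) n) 7)) ∧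
    (19 * n < p → p ≤ 20 * n → (-13 : ℤ) ≤ padicValRat p (casoratian (bLin (15 * n) (15 * n + 2 * n) n) 7)) ∧
    (20 * n < p → p ≤ 21 * n → (-12 : ℤ) ≤ padicValRat p (casoratian (bLin (15 * n) (15 * n + 2 * n) n) 7)) ∧
    (21 * n < p → p ≤ 22 * n → (-11 : ℤ) ≤ padicValRat p (casoratian (bLin (15 * n) (15 * n + 2 * n) n) 7)) :=
  ⟨fun hA hB => cell2 15 n p (by norm_num) hn hp (by omega) (by omega) hne,
   fun hA hB => cell3 15 n p (by norm_num) hn hp (by omega) (by omega) hne,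
   fun hA hB => cell4 15 n p (by norm_num) hn hp (by omega) (by omega) hne,
   fun hA hB => cell5 15 n p (by norm_num) hn hp (by omega) (by omega) hne,
   fun hA hB => cell6 15 n p (by norm_num) hn hp (by omega) (by omega) hne⟩

/-- **B20** (`a = (20,22,22,21,24,28,30,25)`, `t = 17`, dual ray `n·(65; 23,…,17)`): the same five cells `19n < p ≤ 24n` (top cell
`19n < p ≤ 20n`: the provable `−14`; then `−13, −13, −12, −11`). -/
theorem b20_cells (n p : ℕ) (hn : 1 ≤ n) (hp : p.Prime) (hne : casoratian (bLin (17 * n) (17 * n + 2 * n) n) 7 ≠ 0) :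
    (19 * n < p → p ≤ 20 * n → (-14 : ℤ) ≤ padicValRat p (casoratian (bLin (17 * n) (17 * n + 2 * n) n) 7)) ∧
    (20 * n < p → p ≤ 21 * n → (-13 : ℤ) ≤ padicValRat p (casoratian (bLin (17 * n) (17 * n + 2 * n) n) 7)) ∧
    (21 * n < p → p ≤ 22 * n → (-13 : ℤ) ≤ padicValRat p (casoratian (bLin (17 * n) (17 * n + 2 * n) n) 7)) ∧
    (22 * n < p → p ≤ 23 * n → (-12 : ℤ) ≤ padicValRat p (casoratian (bLin (17 * n) (17 * n + 2 * n) n) 7)) ∧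
    (23 * n < p → p ≤ 24 * n → (-11 : ℤ) ≤ padicValRat p (casoratian (bLin (17 * n) (17 * n + 2 * n) n) 7)) :=
  ⟨fun hA hB => cell2 17 n p (by norm_num) hn hp (by omega) (by omega) hne,
   fun hA hB => cell3 17 n p (by norm_num) hn hp (by omega) (by omega) hne,
   fun hA hB => cell4 17 n p (by norm_num) hn hp (by omega) (by omega) hne,
   fun hA hB => cell5 17 n p (by norm_num) hn hp (by omega) (by omega) hne,
   fun hA hB => cell6 17 n p (by norm_num) hn hp (by omega) (by omega) hne⟩

end Directions

end Summit.KontsevichZagierPeriods.Zeta5Search.DenomLaw
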